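import Summits.ABC.IUTFork.Cor312GenuineKDeepPlace
import Literature.IUT.LogVolume.GenuineTowerFacts
import Literature.IUT.LogVolume.SubThetaFieldRamificationBound
import Literature.IUT.LogVolume.Corollary22QParamBaseChange
import Literature.IUT.LogVolume.HeightDivisor
import Literature.NumberTheory.DiophantineGeometry.GenEllMellReduction
import Literature.NumberTheory.NumberFields.UnramifiedDescentPrimeDegree
import HarnessLib

/-!
# [IUTchIII] Cor. 3.12, branch C «HEX-KERNEL» — the DATUM-SIDE glue (brick H6): at a genuine Θ-volume datum of the
# `λ`-line over a pole of `j(λ)` at an odd prime `p ∉ {2,3,5}`, `p ≠ l`, there is a BAD place `x₀ | p` of `K` that is TAME,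
# of bounded ramification, at which the chosen realising q-idele is the EXPLICIT power `p^{−m/(2l·e(v₀|p))}`

PROOF-ONLY support file (D-0012; 0 definitions, 0 `Prop` facts) of the abc-iut cell (Cor. 3.12 sub-crew seat abc-iut-c312-7,
gen 4; row «V6-HSH-FAMILY-VACUITY» / abc-iut-C-cert-1's «HEX-KERNEL», brick H6 = the ∃-package the assembly (H5) `obtain`s).
TAKES NO SIDE on [IUTchIII] Cor. 3.12 (S. Mochizuki, *Inter-universal Teichmüller theory III*, RIMS manuscript, Cor. 3.12
p. 173–174) or on any author: classical algebraic number theory on the cell's typed Θ-volume data.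

CONTEXT. abc-iut-C-cert-1's `Conditional.not_hSH_v6K_of_exists_deep` (p438886) reduces the vacuity of the S_H line of record
`abc_of_SH_v6K` to `hex`: ONE admissible `(P, l, T)` with a prime `p`, a label index `i` and a fibre point `x₀ | p` such that
`p^{((i+2)·(d+a+b)+1)} · ‖t_q(x₀)‖^{(i+1)²−1} < 1`, where `t_q` is the CHOSEN realising q-idele of the `K`-level pilot datum
`Cor312Prov.pilotDataOfK T.D T.K` and `d, a, b` are the [IUTchIV] Prop. 1.1/1.2 constants of `K_{x₀}`. THIS FILE packages,
for a datum `T : Cor22.ThetaVolumeDatumAt P l` (`P ∈ UP`) and a place `v₀ | p` of `F_tpd = P.F` with `ord_{v₀} j(λ) = −m < 0`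
(`p ∉ {2,3,5}`, `p ≠ l`, `p ∤ e(v₀|p)`), the existence of such an `x₀` with EVERY local quantity explicit:

* `placeOf x₀ ∈ S` — the place is BAD for the `K`-level pilot datum: `ord j(E_F) < 0` above `v₀` (`T.j_eq`,
  `Cor22.ord_algebraMap_neg_iff`), so `E_F` is not of good reduction there (`|j|_v ≤ 1` at good places, Silverman AEC VII.5.1 (a),
  the tree's `valuation_j_le_one_of_hasGoodReduction_localMinimalModel`), hence multiplicative by semistability ([IUTchI] Def. 3.1 (b),
  `InitialThetaData.isSemistable`), hence in `𝕍(F)^bad` by the (P5) choice `T.isP5Choice` (`p ∤ 2l`);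
* `¬ p ∣ e(K_{x₀}/ℚ_p)` — TAME: `e(x₀|p) = e(v₀|p)·e(v|v₀)·e(x₀|v)` with `p ∤ e(v|v₀)` (`F/F_tpd` tame away from `{2,3,5}`)
  and `p ∤ e(x₀|v)` (`K/F` tame at bad places not over `l`), both conjuncts of abc-iut-S-d1/S3's
  `Cor22.ThetaVolumeDatumAt.towerFacts` ([IUTchIV] Thm. 1.10 Steps (ii)–(iii));
* `e(K_{x₀}/ℚ_p) ≤ e(v₀|p)·46080·(l(l−1)²(l+1))` — `e(v|v₀) ≤ 46080` (abc-iut-S's `Cor22.ramificationIdx_subThetaField_le`,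
  Step (ii) `Gal(F/F_tpd) ↪ GL₂(𝔽₃)×GL₂(𝔽₅)×ℤ/2`) and `e(x₀|v) ∣ [K:F] ∣ l(l−1)²(l+1)` (`towerFacts`, Step (iii) (E3)
  `Gal(K/F) ↪ GL₂(𝔽_l)`; `ramificationIdx_dvd_finrank_of_isGalois`);
* `‖t_q(x₀)‖ = p^{−(m / (2·l·e(v₀|p)))}` — abc-iut-c312-7 F1 (`Cor312Prov.exists_int_norm_qIdele_pilotDataOfK`,
  `qExponent_div_eq_pilotDataOfK`): the integer exponent over `e(x₀|p)` is `qParamOrd(E_F, v)/(2l·e(v|p))`, and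
  `qParamOrd(E_F, v) = e(v|v₀)·m` (abc-iut-w5-d009 `ThetaData.neg_ord_j_eq_ramificationIdx_mul_qParamOrd_of_under_mem_VFbad` +
  `Cor22.ord_algebraMap_eq`), `e(v|p) = e(v₀|p)·e(v|v₀)` — ALL relative ramification indices CANCEL.

Main theorem: `Conditional.GenuineK.exists_bad_tame_place_of_ord_neg`; corollary `…exists_bad_place_depthConstants_le_of_ord_neg`
(with F1's tame bound); §3 `rpow_mul_pow_lt_one_of_lt` turns «`d+a+b ≤ B`, `‖t_q‖ = p^{−c}`, `(i+2)B + 1 < c((i+1)²−1)`» into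
`hex`'s inequality. For the `λ_k = 1/2 + 2/7^k` family of the tree
(`Cor22.exists_ratPoint_mem_std_two`: `F_tpd = ℚ`, `p = 7`, `m = 2k`, `e(v₀|7) = 1`) this reads `‖t_q(x₀)‖ = 7^{−k/l}`, `7 ∤ e`,
`e ≤ 46080·l⁴`, whence `d + a + b ≤ 2 + log_7(46080·l⁴)` by F1's `differentOrd_add_logRadius_le_of_not_dvd`.
HONEST FRAMING: bookkeeping over OUR typed objects; nothing here bears on the printed inequality of [IUTchIII] Cor. 3.12 or on the
number-level `Cor22.Cor312AtDatum`; typed ≠ proved; instantiated ≠ endorsed.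
[cite: Mochizuki2012, IUTchI Def. 3.1 (b),(c) p. 61–62, Ex. 3.2 (iv) p. 71; IUTchIV Thm. 1.10 Steps (ii)–(iii) p. 24–26, Cor. 2.2 (P2),(P5) p. 45–46]
[cite: NeukirchANT1999, Ch. II Prop. (6.8)] [claim: Mochizuki2012, status: disputed] for every IUT quotation.
-/

noncomputable section

open NumberField IsDedekindDomain

namespace Summit.ABC.IUTFork.Conditional

open Thm311 Thm311.Real Cor312 Cor312Prov Literature.IUT.LogVolume Literature.IUT.HodgeTheaters
  Literature.IUT.LogThetaLattice Literature.NumberTheory.NumberFields Literature.NumberTheory.DiophantineGeometry.GenEll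

variable {P : NFPoint} {l : ℕ} (T : Cor22.ThetaVolumeDatumAt P l)

/-- **Brick H6 (datum-side glue of «HEX-KERNEL»).** For a genuine Θ-volume datum `T` at `(P, l)` with `P ∈ UP`, `l` prime,
a prime `p ∉ {2, 3, 5}`, `p ≠ l`, and a place `v₀` of `F_tpd = P.F` over `p`, unramified-enough (`p ∤ e(v₀|p)`), at which
`j(λ)` has a pole of order `m ≥ 1`: there is a point `x₀` of the fibre over `p` of the index of the `K`-level pilot datum
`pilotDataOfK T.D T.K` whose place is BAD (`∈ S`), TAME (`p ∤ e(K_{x₀}/ℚ_p)`), of ramification `≤ e(v₀|p)·46080·l(l−1)²(l+1)`, and at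
which the CHOSEN realising q-idele (`Exists.choose` of `Cor312Prov.exists_realising_qIdeles_pilotDataOfK`, the one the line of record
`abc_of_SH_v6K` reads) has norm EXACTLY `p^{−m/(2·l·e(v₀|p))}`. [cite: Mochizuki2012, IUTchI Ex. 3.2 (iv) p. 71; IUTchIV Thm. 1.10 Steps (ii)–(iii) p. 24–26]
[claim: Mochizuki2012, status: disputed] -/
theorem GenuineK.exists_bad_tame_place_of_ord_neg (hP : P ∈ UP) (hl : l.Prime) (pp : Nat.Primes)
    (hp2 : (pp : ℕ) ≠ 2) (hp3 : (pp : ℕ) ≠ 3) (hp5 : (pp : ℕ) ≠ 5) (hpl : (pp : ℕ) ≠ l)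
    (v₀ : HeightOneSpectrum (𝓞 P.F)) (hv₀ : ((pp : ℕ) : 𝓞 P.F) ∈ v₀.asIdeal) (hv₀e : ¬ (pp : ℕ) ∣ ramIdx P.F v₀)
    {m : ℕ} (hm : Literature.IUT.LogVolume.ord P.F v₀ (Cor22.jInv P.x) = -(m : ℤ)) (hm0 : 0 < m) :
    letI := T.instFieldF; letI := T.instNumberFieldF; letI := T.instAlgebraF; letI := T.instFieldK
    letI := T.instNumberFieldK; letI := T.instAlgebraK; letI := T.instFieldFbar; letI := T.instAlgebraFbar
    letI := T.instAlgebraKFbar; letI := T.instIsElliptic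
    haveI : Fact (pp : ℕ).Prime := ⟨pp.2⟩
    ∃ x₀ : (thetaIndex (pilotDataOfK T.D T.K)).Fibre (.inr pp),
      placeOf (pilotDataOfK T.D T.K) pp.1 x₀ ∈ (pilotDataOfK T.D T.K).S ∧
      ¬ (pp : ℕ) ∣ absRamificationIdx (pp : ℕ) (kOf (pilotDataOfK T.D T.K) pp.1 x₀) ∧
      absRamificationIdx (pp : ℕ) (kOf (pilotDataOfK T.D T.K) pp.1 x₀) ≤ ramIdx P.F v₀ * 46080 * (l * (l - 1) ^ 2 * (l + 1)) ∧
      ‖(exists_realising_qIdeles_pilotDataOfK T.D).choose pp x₀‖ =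
        ((pp : ℕ) : ℝ) ^ (-((m : ℝ) / (2 * l * ramIdx P.F v₀))) := by
  letI := T.instFieldF; letI := T.instNumberFieldF; letI := T.instAlgebraF; letI := T.instFieldK
  letI := T.instNumberFieldK; letI := T.instAlgebraK; letI := T.instFieldFbar; letI := T.instAlgebraFbar
  letI := T.instAlgebraKFbar; letI := T.instIsElliptic
  haveI : Fact (pp : ℕ).Prime := ⟨pp.2⟩
  have hU : P.InU := hP.1
  set X := pilotDataOfK T.D T.K with hXdef
  -- the nine tower facts (Steps (ii)–(iii))
  obtain ⟨hGalF, hGalK, -, -, hdegK, -, hKbad, -, hFtame⟩ := T.towerFacts hU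
  haveI := hGalF; haveI := hGalK
  -- places: `v` of `F` over `v₀`, `w` of `K` over `v`
  obtain ⟨v, hv⟩ := exists_finBelow_eq (L := T.F) v₀
  obtain ⟨w, hw⟩ := exists_finBelow_eq (L := T.K) v
  have hpv : ((pp : ℕ) : 𝓞 T.F) ∈ v.asIdeal := by
    have : ((pp : ℕ) : 𝓞 T.F) = algebraMap (𝓞 P.F) (𝓞 T.F) ((pp : ℕ) : 𝓞 P.F) := by simp
    rw [this, ← Ideal.mem_comap]
    change ((pp : ℕ) : 𝓞 P.F) ∈ (finBelow P.F T.F v).asIdeal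
    rw [hv]; exact hv₀
  have hpw : ((pp : ℕ) : 𝓞 T.K) ∈ w.asIdeal := by
    have : ((pp : ℕ) : 𝓞 T.K) = algebraMap (𝓞 T.F) (𝓞 T.K) ((pp : ℕ) : 𝓞 T.F) := by simp
    rw [this, ← Ideal.mem_comap]
    change ((pp : ℕ) : 𝓞 T.F) ∈ (finBelow T.F T.K w).asIdeal
    rw [hw]; exact hpv
  have hwchar : residueChar T.K w = (pp : ℕ) := residueChar_eq_of_natCast_mem pp.1 hpw
  have hvchar : residueChar T.F v = (pp : ℕ) := residueChar_eq_of_natCast_mem pp.1 hpv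
  -- the fibre point `x₀` with `placeOf x₀ = w`
  have hwover : w ∈ placesOver T.K (pp : ℕ) := (mem_placesOver_iff_residueChar w).mpr hwchar
  let x₀ : (thetaIndex X).Fibre (.inr pp) := (fibreEquivPlacesOver X pp).symm ⟨w, hwover⟩
  have hx₀ : placeOf X pp.1 x₀ = w := by
    change ((fibreEquivPlacesOver X pp) ((fibreEquivPlacesOver X pp).symm ⟨w, hwover⟩)).1 = w
    rw [Equiv.apply_symm_apply]
  -- `v₀` is a pole of `j(λ)`, so `v` is a bad place of the point over `F`, so `E_F` is multiplicative at `v`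
  have hv₀bad : v₀ ∈ Cor22.badPlaces P := by
    rw [Cor22.mem_badPlaces_iff_ord_neg, hm]
    have : (0 : ℤ) < m := by exact_mod_cast hm0
    linarith
  -- `ord_v j(E_F) < 0`, so `E_F` is NOT of good reduction at `v` (`|j|_v ≤ 1` at good places), hence multiplicative (semistable)
  have hordv : Literature.IUT.LogVolume.ord T.F v T.E.j < 0 := by
    rw [T.j_eq, Cor22.ord_algebraMap_neg_iff v, hv, hm]
    have : (0 : ℤ) < m := by exact_mod_cast hm0
    linarith
  have hj0 : T.E.j ≠ 0 := by
    intro h0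
    rw [h0, ord_zero] at hordv
    exact lt_irrefl _ hordv
  have hmult : T.E.HasMultiplicativeReductionAt v := by
    rcases T.D.isSemistable v with hgood | hmult
    · have h1 : v.valuation T.F T.E.j ≤ 1 := valuation_j_le_one_of_hasGoodReduction_localMinimalModel v T.E hgood
      have h2 : 1 < v.valuation T.F T.E.j := (ord_neg_iff_one_lt_valuation T.F v hj0).mp hordv
      exact absurd h1 (not_le.mpr h2)
    · exact hmult
  -- hence `v ∈ 𝕍(F)^bad` by the (P5) choice (`p ∤ 2l`)
  have hvVFbad : FinitePlace.mk v ∈ T.D.VFbad := by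
    rw [T.isP5Choice (FinitePlace.mk v), FinitePlace.maximalIdeal_mk]
    refine ⟨fun q hq hqv => ?_, hmult⟩
    simp only [Finset.mem_insert, Finset.mem_singleton] at hq
    have hq' : q = (pp : ℕ) := by
      rcases hq with rfl | rfl
      · exact eq_of_natCast_mem_of_prime pp.1 v.isPrime.ne_top Nat.prime_two hqv hpv
      · exact eq_of_natCast_mem_of_prime pp.1 v.isPrime.ne_top hl hqv hpv
    rcases hq with rfl | rfl
    · exact hp2 hq'.symm
    · exact hpl hq'.symm
  -- so `w ∈ S` for the `K`-level pilot datum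
  have hwS : w ∈ X.S := by
    rw [hXdef, mem_pilotDataOfK_S_iff, hw]; exact hvVFbad
  have hx₀S : placeOf X pp.1 x₀ ∈ X.S := by rw [hx₀]; exact hwS
  -- ramification bookkeeping: `e(w|p) = e(v₀|p)·e(v|v₀)·e(w|v)`
  have hv_under : v.under (𝓞 P.F) = v₀ := hv
  have hw_under : w.under (𝓞 T.F) = v := hw
  haveI hwv : w.asIdeal.LiesOver v.asIdeal := by rw [← hw_under]; exact ⟨rfl⟩
  haveI hvv₀ : v.asIdeal.LiesOver v₀.asIdeal := by rw [← hv_under]; exact ⟨rfl⟩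
  haveI : v.asIdeal.IsMaximal := v.isMaximal
  haveI : v₀.asIdeal.IsMaximal := v₀.isMaximal
  have hewv : Ideal.ramificationIdx' v.asIdeal w.asIdeal = w.asIdeal.ramificationIdx (𝓞 T.F) :=
    Ideal.ramificationIdx'_eq_ramificationIdx v.asIdeal w.asIdeal v.ne_bot
  have hevv₀ : Ideal.ramificationIdx' v₀.asIdeal v.asIdeal = v.asIdeal.ramificationIdx (𝓞 P.F) :=
    Ideal.ramificationIdx'_eq_ramificationIdx v₀.asIdeal v.asIdeal v₀.ne_bot
  have hew : w.asIdeal.ramificationIdx ℤ =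
      ramIdx P.F v₀ * Ideal.ramificationIdx' v₀.asIdeal v.asIdeal * Ideal.ramificationIdx' v.asIdeal w.asIdeal := by
    rw [ThetaData.absRamificationIdx_eq_ramIdx_mul (F := T.F) w, hw_under, ramIdx_eq,
      ThetaData.absRamificationIdx_eq_ramIdx_mul (F := P.F) v, hv_under]
  have hekOf : absRamificationIdx (pp : ℕ) (kOf X pp.1 x₀) = w.asIdeal.ramificationIdx ℤ := by
    have hpx : ((pp : ℕ) : 𝓞 T.K) ∈ (placeOf X pp.1 x₀).asIdeal := natCast_mem_placeOf X pp.1 x₀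
    rw [show absRamificationIdx (pp : ℕ) (kOf X pp.1 x₀) =
        absRamificationIdx (pp : ℕ) (RescaledCompletion T.K pp.1 (placeOf X pp.1 x₀) hpx) from rfl,
      absRamificationIdx_rescaledCompletion]
    simp only [hx₀]
  -- tameness of the two relative layers at `p`
  have htameK : ¬ (pp : ℕ) ∣ Ideal.ramificationIdx' v.asIdeal w.asIdeal := by
    rw [hewv]
    have h := hKbad w (by rw [hwchar]; exact hpl) (by
      change finBelow P.F T.F (finBelow T.F T.K w) ∈ Cor22.badPlaces P
      rw [hw, hv]; exact hv₀bad)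
    rwa [hwchar] at h
  have htameF : ¬ (pp : ℕ) ∣ Ideal.ramificationIdx' v₀.asIdeal v.asIdeal := by
    rw [hevv₀]
    have h := hFtame v (by
      rw [hvchar]
      simp only [Finset.mem_insert, Finset.mem_singleton, not_or]
      exact ⟨hp2, hp3, hp5⟩)
    rwa [hvchar] at h
  have htame : ¬ (pp : ℕ) ∣ absRamificationIdx (pp : ℕ) (kOf X pp.1 x₀) := by
    rw [hekOf, hew]
    intro h
    rcases (Nat.Prime.dvd_mul pp.2).1 h with h12 | h3
    · rcases (Nat.Prime.dvd_mul pp.2).1 h12 with h1 | h2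
      · exact hv₀e h1
      · exact htameF h2
    · exact htameK h3
  -- the bound `e(w|p) ≤ e(v₀|p)·46080·l(l−1)²(l+1)`
  have hevv₀le : Ideal.ramificationIdx' v₀.asIdeal v.asIdeal ≤ 46080 := by
    rw [hevv₀]
    refine Cor22.ramificationIdx_subThetaField_le T.F hU T.isSubThetaField v ?_
    change ¬ ((2 : ℕ) : 𝓞 P.F) ∈ (finBelow P.F T.F v).asIdeal
    rw [hv]
    intro h2
    exact hp2 (eq_of_natCast_mem_of_prime pp.1 v₀.isPrime.ne_top Nat.prime_two h2 hv₀).symm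
  have hewvle : Ideal.ramificationIdx' v.asIdeal w.asIdeal ≤ l * (l - 1) ^ 2 * (l + 1) := by
    rw [hewv]
    have hdvd : w.asIdeal.ramificationIdx (𝓞 T.F) ∣ Module.finrank T.F T.K :=
      ramificationIdx_dvd_finrank_of_isGalois (F := T.F) (E := T.K) v.asIdeal w.asIdeal
    exact Nat.le_of_dvd (by
      have h2 : 2 ≤ l := hl.two_le
      have : 0 < l - 1 := by omega
      positivity) (hdvd.trans hdegK)
  have hbound : absRamificationIdx (pp : ℕ) (kOf X pp.1 x₀) ≤ ramIdx P.F v₀ * 46080 * (l * (l - 1) ^ 2 * (l + 1)) := by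
    rw [hekOf, hew]
    exact Nat.mul_le_mul (Nat.mul_le_mul le_rfl hevv₀le) hewvle
  -- the norm of the chosen realising q-idele at `x₀`
  obtain ⟨mq, hmq, hnorm⟩ := exists_int_norm_qIdele_pilotDataOfK T.D pp
    (exists_realising_qIdeles_pilotDataOfK T.D).choose (exists_realising_qIdeles_pilotDataOfK T.D).choose_spec.1
    (exists_realising_qIdeles_pilotDataOfK T.D).choose_spec.2.2 x₀ hx₀S
  have hexp := qExponent_div_eq_pilotDataOfK T.D pp x₀ hx₀S hmq
  -- `qParamOrd E v = e(v|v₀)·m`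
  have hfb : finBelow T.F T.K (placeOf X pp.1 x₀) = v := by rw [hx₀]; exact hw
  have hq : (qParamOrd T.E v : ℤ) = (Ideal.ramificationIdx' v₀.asIdeal v.asIdeal : ℤ) * m := by
    have h1 := ThetaData.neg_ord_j_eq_ramificationIdx_mul_qParamOrd_of_under_mem_VFbad T.D (w := w)
      (by rw [hw_under]; exact hvVFbad)
    rw [hw_under] at h1
    have h2 : Literature.IUT.LogVolume.ord T.K w (algebraMap T.F T.K T.E.j) =
        (Ideal.ramificationIdx' v.asIdeal w.asIdeal : ℤ) * ((Ideal.ramificationIdx' v₀.asIdeal v.asIdeal : ℤ) * (-(m : ℤ))) := by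
      rw [Cor22.ord_algebraMap_eq w, hw, T.j_eq, Cor22.ord_algebraMap_eq v, hv, hm]
    rw [h2] at h1
    have hne : (Ideal.ramificationIdx' v.asIdeal w.asIdeal : ℤ) ≠ 0 := by
      exact_mod_cast Ideal.IsDedekindDomain.ramificationIdx'_ne_zero_of_liesOver w.asIdeal v.ne_bot
    have h3 : (Ideal.ramificationIdx' v.asIdeal w.asIdeal : ℤ) * (qParamOrd T.E v : ℤ) =
        (Ideal.ramificationIdx' v.asIdeal w.asIdeal : ℤ) * ((Ideal.ramificationIdx' v₀.asIdeal v.asIdeal : ℤ) * m) := by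
      linarith
    exact mul_left_cancel₀ hne h3
  -- `ramIdx F v = e(v₀|p)·e(v|v₀)`
  have hramv : (ramIdx T.F v : ℝ) = (ramIdx P.F v₀ : ℝ) * Ideal.ramificationIdx' v₀.asIdeal v.asIdeal := by
    rw [ramIdx_eq, ThetaData.absRamificationIdx_eq_ramIdx_mul (F := P.F) v, hv_under]
    push_cast
    rfl
  refine ⟨x₀, hx₀S, htame, hbound, ?_⟩
  rw [hnorm, hexp, hfb]
  congr 1
  have hl0 : (l : ℝ) ≠ 0 := by exact_mod_cast hl.ne_zero
  have he0 : (ramIdx P.F v₀ : ℝ) ≠ 0 := by exact_mod_cast ramIdx_ne_zero P.F v₀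
  have hr0 : (Ideal.ramificationIdx' v₀.asIdeal v.asIdeal : ℝ) ≠ 0 := by
    exact_mod_cast Ideal.IsDedekindDomain.ramificationIdx'_ne_zero_of_liesOver v.asIdeal v₀.ne_bot
  have hq' : (qParamOrd T.E v : ℝ) = (Ideal.ramificationIdx' v₀.asIdeal v.asIdeal : ℝ) * m := by exact_mod_cast hq
  rw [hq', hramv]
  field_simp

/-- **Corollary (with F1's tame constant bound): the Prop. 1.1/1.2 constants at that place** — for `p ≥ 5` the place `x₀` of
`GenuineK.exists_bad_tame_place_of_ord_neg` has `d + a + b ≤ 2 + log(e(v₀|p)·46080·l(l−1)²(l+1))/log p`, the per-factor exponent of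
abc-iut-w5-d107's / abc-iut-C-cert-1's explicit depth inequality (`Conditional.not_hSH_v6K_of_exists_deep`, hypothesis `hex`).
[cite: Mochizuki2012, IUTchIV Prop. 1.2 p. 10, Thm. 1.10 Steps (ii)–(iii) p. 24–26] [claim: Mochizuki2012, status: disputed] -/
theorem GenuineK.exists_bad_place_depthConstants_le_of_ord_neg (hP : P ∈ UP) (hl : l.Prime) (pp : Nat.Primes)
    (hp5le : 5 ≤ (pp : ℕ)) (hp5 : (pp : ℕ) ≠ 5) (hpl : (pp : ℕ) ≠ l)
    (v₀ : HeightOneSpectrum (𝓞 P.F)) (hv₀ : ((pp : ℕ) : 𝓞 P.F) ∈ v₀.asIdeal) (hv₀e : ¬ (pp : ℕ) ∣ ramIdx P.F v₀)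
    {m : ℕ} (hm : Literature.IUT.LogVolume.ord P.F v₀ (Cor22.jInv P.x) = -(m : ℤ)) (hm0 : 0 < m) :
    letI := T.instFieldF; letI := T.instNumberFieldF; letI := T.instAlgebraF; letI := T.instFieldK
    letI := T.instNumberFieldK; letI := T.instAlgebraK; letI := T.instFieldFbar; letI := T.instAlgebraFbar
    letI := T.instAlgebraKFbar; letI := T.instIsElliptic
    haveI : Fact (pp : ℕ).Prime := ⟨pp.2⟩
    ∃ x₀ : (thetaIndex (pilotDataOfK T.D T.K)).Fibre (.inr pp),
      placeOf (pilotDataOfK T.D T.K) pp.1 x₀ ∈ (pilotDataOfK T.D T.K).S ∧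
      differentOrd (pp : ℕ) (kOf (pilotDataOfK T.D T.K) pp.1 x₀)
          + logRadiusA (pp : ℕ) (absRamificationIdx (pp : ℕ) (kOf (pilotDataOfK T.D T.K) pp.1 x₀))
          + logRadiusB (pp : ℕ) (absRamificationIdx (pp : ℕ) (kOf (pilotDataOfK T.D T.K) pp.1 x₀)) ≤
        2 + Real.log (((ramIdx P.F v₀ * 46080 * (l * (l - 1) ^ 2 * (l + 1)) : ℕ) : ℝ)) / Real.log (pp : ℕ) ∧
      ‖(exists_realising_qIdeles_pilotDataOfK T.D).choose pp x₀‖ =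
        ((pp : ℕ) : ℝ) ^ (-((m : ℝ) / (2 * l * ramIdx P.F v₀))) := by
  letI := T.instFieldF; letI := T.instNumberFieldF; letI := T.instAlgebraF; letI := T.instFieldK
  letI := T.instNumberFieldK; letI := T.instAlgebraK; letI := T.instFieldFbar; letI := T.instAlgebraFbar
  letI := T.instAlgebraKFbar; letI := T.instIsElliptic
  haveI : Fact (pp : ℕ).Prime := ⟨pp.2⟩
  have hp2 : (pp : ℕ) ≠ 2 := by omega
  have hp3 : (pp : ℕ) ≠ 3 := by omega
  obtain ⟨x₀, hS, htame, hbound, hnorm⟩ :=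
    GenuineK.exists_bad_tame_place_of_ord_neg T hP hl pp hp2 hp3 hp5 hpl v₀ hv₀ hv₀e hm hm0
  refine ⟨x₀, hS, ?_, hnorm⟩
  have h := differentOrd_add_logRadius_le_of_not_dvd (pp : ℕ) (kOf (pilotDataOfK T.D T.K) pp.1 x₀) hp5le htame
  refine h.trans ?_
  have hp1 : (1 : ℝ) < (pp : ℕ) := by exact_mod_cast pp.2.one_lt
  have hlogp : 0 < Real.log (pp : ℕ) := Real.log_pos hp1
  have he0 : 0 < absRamificationIdx (pp : ℕ) (kOf (pilotDataOfK T.D T.K) pp.1 x₀) := absRamificationIdx_pos _ _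
  have hmono : Real.log (absRamificationIdx (pp : ℕ) (kOf (pilotDataOfK T.D T.K) pp.1 x₀)) ≤
      Real.log (((ramIdx P.F v₀ * 46080 * (l * (l - 1) ^ 2 * (l + 1)) : ℕ) : ℝ)) :=
    Real.log_le_log (by exact_mod_cast he0) (by exact_mod_cast hbound)
  have := div_le_div_of_nonneg_right hmono hlogp.le
  linarith

/-! ## §3. The arithmetic of the explicit depth inequality -/

omit T in
/-- **From bounds to `hex`'s inequality.** For `p > 1`: if the per-factor constant `X (= d+a+b)` is at most `B` and
`((i+2)·B + 1) < c·((i+1)² − 1)`, then `p^{((i+2)·X+1)} · (p^{−c})^{(i+1)²−1} < 1` — the shape of the hypothesis `hex` of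
abc-iut-C-cert-1's `Conditional.not_hSH_v6K_of_exists_deep` once `‖t_q(x₀)‖ = p^{−c}` is substituted. [folklore] -/
theorem rpow_mul_pow_lt_one_of_lt {p : ℝ} (hp : 1 < p) {X B c : ℝ} {i : ℕ} (hX : X ≤ B)
    (h : (((i : ℕ) : ℝ) + 2) * B + 1 < c * ((((i : ℕ) + 1) ^ 2 - 1 : ℕ) : ℝ)) :
    p ^ ((((i : ℕ) : ℝ) + 2) * X + 1) * (p ^ (-c)) ^ (((i : ℕ) + 1) ^ 2 - 1) < 1 := by
  have hp0 : 0 < p := lt_trans zero_lt_one hp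
  rw [← Real.rpow_natCast, ← Real.rpow_mul hp0.le, ← Real.rpow_add hp0]
  apply Real.rpow_lt_one_of_one_lt_of_neg hp
  have hi : (0 : ℝ) ≤ ((i : ℕ) : ℝ) + 2 := by positivity
  nlinarith [mul_le_mul_of_nonneg_left hX hi]

end Summit.ABC.IUTFork.Conditional

end
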